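import Literature.Topology.FourManifolds.SimplifiedBrokenLefschetzSphereSideTube
import Summits.SmoothPoincare4.SmoothPoincare4.Theorems.SblfDescentRungOneStubBaseFunctionLagrange
import HarnessLib

/-!
# The longitude of the sphere-side product structure (layer `f3_longitude`)

Auxiliary file (layer 4) of stub `helper_sliceGluing_bottConstruction` (apex brick F3: the
construction of the Morse–Bott function `F` and of the angular map `α`), line `Sketch`, crux
`SblfDescent.RungOne`.

(Crux item stmt-SmoothPoincare4-18531; skeleton `Cruxes/RungOne/Lines/Sketch.lean`.)

The sphere side of the fibration is parametrised by `ιX : S² × ℝ² → X` with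
`f (ιX (θ, w)) = σᵥ⁻¹ (univBall 0 2 w)`, `σᵥ` Mathlib's stereographic chart from the pole
`v = (0, 0, ±1)`.  The angular map `α` of brick F3 must equal `√2 · w` on the level
`⟪f, v⟫ = -1/2` (`|w|² = 1/2`) and be built from the *longitude* `(f₀, f₁)/‖(f₀, f₁)‖` of `f`;
this file identifies the two: **there is a linear isometry `O` of the plane with
`(f₀, f₁) (ιX (θ, w)) = c(w) · O w`, `c(w) = 2 √(1 + |w|²) / (1 + 2 |w|²) > 0`, and
`f₂ (ιX (θ, w)) = -v₂ / (1 + 2|w|²)`** (`helper_f3_longitude`).  Here `O` is the (unspecified)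
orthonormal basis of `vᗮ` chosen by Mathlib's `stereographic'`, read in the coordinates
`(y₀, y₁)` of the plane `vᗮ = {y₂ = 0}`; the scalar comes from
`σᵥ⁻¹ z = (4 z + (|z|² - 4) v) / (|z|² + 4)` (`stereoInvFunAux`) at `z = 2w/√(1 + |w|²)`.

## References

* J. Milnor, *Morse theory*, Ann. of Math. Studies 51 (1963), §2–§3. [Milnor1963]
-/

set_option linter.dupNamespace false

noncomputable section

open scoped Manifold ContDiff Topology RealInnerProductSpace
open Set Function Literature.Topology.FourManifolds

namespace Summit.SmoothPoincare4.SmoothPoincare4.Cruxes.RungOne.Sketch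

/-- A rational identity: `(c² s' + 4)⁻¹ · 4 c = 2 √s / (1 + 2 s')` for `s = 1 + s'`,
`c = 2/√s`. [folklore] -/
theorem longitude_scalar_aux {t : ℝ} (ht : 0 ≤ t) :
    ((2 * (√(1 + t))⁻¹) ^ 2 * t + 4)⁻¹ * (4 * (2 * (√(1 + t))⁻¹)) =
      2 * √(1 + t) / (1 + 2 * t) := by
  have hs : 0 < 1 + t := by linarith
  have hr : 0 < √(1 + t) := Real.sqrt_pos.2 hs
  have hr2 : √(1 + t) ^ 2 = 1 + t := Real.sq_sqrt hs.le
  have h2 : 0 < 1 + 2 * t := by linarith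
  field_simp
  rw [hr2]
  ring

/-- A rational identity: `(c² s' + 4)⁻¹ (c² s' - 4) = -1/(1 + 2 s')` for `c = 2/√(1 + s')`.
[folklore] -/
theorem height_scalar_aux {t : ℝ} (ht : 0 ≤ t) :
    ((2 * (√(1 + t))⁻¹) ^ 2 * t + 4)⁻¹ * ((2 * (√(1 + t))⁻¹) ^ 2 * t - 4) = -(1 + 2 * t)⁻¹ := by
  have hs : 0 < 1 + t := by linarith
  have hr : 0 < √(1 + t) := Real.sqrt_pos.2 hs
  have hr2 : √(1 + t) ^ 2 = 1 + t := Real.sq_sqrt hs.le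
  have h2 : 0 < 1 + 2 * t := by linarith
  field_simp
  rw [hr2]
  ring

/-- **Layer `f3_longitude` of brick F3: the longitude of the sphere-side product structure.**
For a pole `v = (0, 0, ±1)` of `S²` there is a linear isometry `O` of the plane such that the
parametrised hemisphere `w ↦ σᵥ⁻¹ (univBall 0 2 w)` (Mathlib's stereographic chart from `v`
composed with the radial diffeomorphism onto the disc of radius `2`) has planar part
`c(w) · O w` with `c(w) = 2 √(1 + |w|²) / (1 + 2|w|²)` and third coordinate
`-v₂ / (1 + 2 |w|²)`; in particular its longitude is `O (w/|w|)` and its height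
`⟪·, v⟫ = -1/(1 + 2|w|²)`.  (`O` is the orthonormal basis of `vᗮ` chosen by `stereographic'`,
read in the plane `{y₂ = 0}`; the `Fact` binder is the dimension instance needed by
`stereographic'`, supplied in the line's files by `fact_finrank_euclideanSpace_succ`.)
[cite: Milnor1963, §2] -/
theorem helper_f3_longitude : ∀ [Fact (Module.finrank ℝ (EuclideanSpace ℝ (Fin 3)) = 2 + 1)] (v : Metric.sphere (0 : EuclideanSpace ℝ (Fin 3)) 1), (v : EuclideanSpace ℝ (Fin 3)) 0 = 0 → (v : EuclideanSpace ℝ (Fin 3)) 1 = 0 → ∃ O : EuclideanSpace ℝ (Fin 2) ≃ₗᵢ[ℝ] EuclideanSpace ℝ (Fin 2), ∀ w : EuclideanSpace ℝ (Fin 2), (((stereographic' 2 v).symm (OpenPartialHomeomorph.univBall (0 : EuclideanSpace ℝ (Fin 2)) 2 w) : Metric.sphere (0 : EuclideanSpace ℝ (Fin 3)) 1) : EuclideanSpace ℝ (Fin 3)) 0 = 2 * √(1 + ‖w‖ ^ 2) / (1 + 2 * ‖w‖ ^ 2) * (O w) 0 ∧ (((stereographic' 2 v).symm (OpenPartialHomeomorph.univBall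 (0 : EuclideanSpace ℝ (Fin 2)) 2 w) : Metric.sphere (0 : EuclideanSpace ℝ (Fin 3)) 1) : EuclideanSpace ℝ (Fin 3)) 1 = 2 * √(1 + ‖w‖ ^ 2) / (1 + 2 * ‖w‖ ^ 2) * (O w) 1 ∧ (((stereographic' 2 v).symm (OpenPartialHomeomorph.univBall (0 : EuclideanSpace ℝ (Fin 2)) 2 w) : Metric.sphere (0 : EuclideanSpace ℝ (Fin 3)) 1) : EuclideanSpace ℝ (Fin 3)) 2 = -(v : EuclideanSpace ℝ (Fin 3)) 2 / (1 + 2 * ‖w‖ ^ 2) := by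
  intro _ v hv0 hv1
  have hv2 : (v : EuclideanSpace ℝ (Fin 3)) 2 ^ 2 = 1 := pole_sq v hv0 hv1
  have hv2ne : (v : EuclideanSpace ℝ (Fin 3)) 2 ≠ 0 := by
    intro h; rw [h] at hv2; norm_num at hv2
  -- Mathlib's orthonormal basis of `vᗮ`
  set B := (OrthonormalBasis.fromOrthogonalSpanSingleton (𝕜 := ℝ) 2
    (ne_zero_of_mem_unit_sphere v)).repr.symm with hB
  -- its vectors lie in the plane `{y₂ = 0}`
  have hB2 : ∀ w : EuclideanSpace ℝ (Fin 2), ((B w : EuclideanSpace ℝ (Fin 3))) 2 = 0 := by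
    intro w
    have hm : ((B w : EuclideanSpace ℝ (Fin 3))) ∈ (ℝ ∙ (v : EuclideanSpace ℝ (Fin 3)))ᗮ :=
      (B w).2
    rw [Submodule.mem_orthogonal_singleton_iff_inner_right, real_inner_comm,
      inner_pole v hv0 hv1] at hm
    rcases mul_eq_zero.1 hm with h | h
    · exact h
    · exact absurd h hv2ne
  -- and have the same norm as `w`
  have hB1 : ∀ w : EuclideanSpace ℝ (Fin 2), ‖((B w : EuclideanSpace ℝ (Fin 3)))‖ = ‖w‖ :=
    fun w => by rw [Submodule.norm_coe, LinearIsometryEquiv.norm_map]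
  have hBn : ∀ w : EuclideanSpace ℝ (Fin 2),
      ((B w : EuclideanSpace ℝ (Fin 3))) 0 ^ 2 + ((B w : EuclideanSpace ℝ (Fin 3))) 1 ^ 2 =
        ‖w‖ ^ 2 := by
    intro w
    have h3 : ‖((B w : EuclideanSpace ℝ (Fin 3)))‖ ^ 2 =
        ((B w : EuclideanSpace ℝ (Fin 3))) 0 ^ 2 + ((B w : EuclideanSpace ℝ (Fin 3))) 1 ^ 2 +
          ((B w : EuclideanSpace ℝ (Fin 3))) 2 ^ 2 := by
      rw [EuclideanSpace.real_norm_sq_eq, Fin.sum_univ_three]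
    rw [hB2 w, hB1 w] at h3
    linear_combination -h3
  -- the planar part of `B`, a linear isometry of the plane
  let L : EuclideanSpace ℝ (Fin 2) →ₗ[ℝ] EuclideanSpace ℝ (Fin 2) :=
    { toFun := fun w => !₂[((B w : EuclideanSpace ℝ (Fin 3))) 0, ((B w : EuclideanSpace ℝ (Fin 3))) 1]
      map_add' := by
        intro x y
        ext i
        fin_cases i <;> simp
      map_smul' := by
        intro c x
        ext i
        fin_cases i <;> simp }
  have hL0 : ∀ w, (L w) 0 = ((B w : EuclideanSpace ℝ (Fin 3))) 0 := fun w => by simp [L]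
  have hL1 : ∀ w, (L w) 1 = ((B w : EuclideanSpace ℝ (Fin 3))) 1 := fun w => by simp [L]
  have hLn : ∀ w, ‖L w‖ = ‖w‖ := by
    intro w
    have h : ‖L w‖ ^ 2 = ‖w‖ ^ 2 := by
      rw [EuclideanSpace.real_norm_sq_eq, Fin.sum_univ_two, hL0, hL1, hBn]
    exact (pow_left_inj₀ (norm_nonneg _) (norm_nonneg _) two_ne_zero).1 h
  let Oli : EuclideanSpace ℝ (Fin 2) →ₗᵢ[ℝ] EuclideanSpace ℝ (Fin 2) := ⟨L, hLn⟩
  let O : EuclideanSpace ℝ (Fin 2) ≃ₗᵢ[ℝ] EuclideanSpace ℝ (Fin 2) := Oli.toLinearIsometryEquiv rfl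
  have hO : ∀ w, O w = L w := fun w => rfl
  refine ⟨O, fun w => ?_⟩
  -- the parametrised hemisphere in coordinates
  have hz := SphereSideTube.univBall_zero_two_eq_smul w
  set c : ℝ := 2 * (√(1 + ‖w‖ ^ 2))⁻¹ with hc
  have hy : ((((stereographic' 2 v).symm
      (OpenPartialHomeomorph.univBall (0 : EuclideanSpace ℝ (Fin 2)) 2 w) :
        Metric.sphere (0 : EuclideanSpace ℝ (Fin 3)) 1) : EuclideanSpace ℝ (Fin 3))) =
      stereoInvFunAux (v : EuclideanSpace ℝ (Fin 3)) (c • (B w : EuclideanSpace ℝ (Fin 3))) := by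
    rw [coe_stereographic'_symm, ← hB, hz, map_smul, Submodule.coe_smul]
  have hnorm : ‖c • (B w : EuclideanSpace ℝ (Fin 3))‖ ^ 2 = c ^ 2 * ‖w‖ ^ 2 := by
    rw [norm_smul, mul_pow, hB1, Real.norm_eq_abs, sq_abs]
  have ht : (0 : ℝ) ≤ ‖w‖ ^ 2 := sq_nonneg _
  have key0 := longitude_scalar_aux ht
  have key2 := height_scalar_aux ht
  rw [hy, stereoInvFunAux_apply, hnorm]
  refine ⟨?_, ?_, ?_⟩
  · rw [hO, hL0]
    simp only [PiLp.smul_apply, PiLp.add_apply, smul_eq_mul, hv0, mul_zero, add_zero]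
    rw [← key0, hc]
    ring
  · rw [hO, hL1]
    simp only [PiLp.smul_apply, PiLp.add_apply, smul_eq_mul, hv1, mul_zero, add_zero]
    rw [← key0, hc]
    ring
  · simp only [PiLp.smul_apply, PiLp.add_apply, smul_eq_mul, hB2, mul_zero, zero_add]
    rw [div_eq_mul_inv, hc]
    have := key2
    rw [← hc] at this ⊢
    calc (c ^ 2 * ‖w‖ ^ 2 + 4)⁻¹ * ((c ^ 2 * ‖w‖ ^ 2 - 4) * (v : EuclideanSpace ℝ (Fin 3)) 2)
        = ((c ^ 2 * ‖w‖ ^ 2 + 4)⁻¹ * (c ^ 2 * ‖w‖ ^ 2 - 4)) * (v : EuclideanSpace ℝ (Fin 3)) 2 := by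
          ring
      _ = -(1 + 2 * ‖w‖ ^ 2)⁻¹ * (v : EuclideanSpace ℝ (Fin 3)) 2 := by rw [this]
      _ = -(v : EuclideanSpace ℝ (Fin 3)) 2 * (1 + 2 * ‖w‖ ^ 2)⁻¹ := by ring

end Summit.SmoothPoincare4.SmoothPoincare4.Cruxes.RungOne.Sketch

end
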